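import Summits.BirchSwinnertonDyer.Rank1Residual.X10.SurjThreeShaCells
import Literature.GroupTheory.FiniteAbelian.AlternatingPairing
import Literature.NumberTheory.EllipticCurves.BSDShaProofs
import HarnessLib

/-!
# Row D3 ∩ {r = 0}, the LAST cell: `#Ш_an = 81` with `dim_𝔽₃ Sel^(3)(E/ℚ) = 2` — what closes it per pair,
# TYPED: Wuthrich Prop. 21 (upper) + ONE exact `3`-descent + ONE element of order `9` in `Ш(E/ℚ)`
# (a `9`-covering certificate) + the Cassels–Tate pairing (bsd.S18) ⟹ Miller's `BSD(E,3)`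
# (cell `b2b-bsdres`, unit `b2b-bsdres-x10` = X10 / N2 class lead, GEN 43; TOOL — theorems only, no definition,
# no new named fact, nothing booked; types-the-object-of, closes NONE by itself)

HONEST FRAMING (run/shared/lean/b2b/bsd-rank1-residual/, verbatim in every file): the goal of the
cell is to DELETE the COMBINATION-SHAPED residual classes of the Birch–Swinnerton-Dyer formula for
ALL analytic-rank `≤ 1` elliptic curves over `ℚ` — "full BSD formula for every rank `≤ 1` curve in
class `C`" assembled STRICTLY from published theorems — so that the rank-`≤ 1` remainder becomes
exactly the CONSTRUCTION-SHAPED classes, which are TYPED (missing-input `Prop`s), NOT attempted.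
This is not "finishing BSD".  X10a′ = X10 ∧ surj(3) is CLOSED (PUB*) AS A CLASS by Yan–Zhu 2026 Thm. 4.15 under
the register flag `YZ26@3-BF-ERL-Ohta` (row D3); THIS FILE books nothing and touches no class statement.
PARTITION (D-0054): D3 / X10a′ × p = 3 × r = 0 × `#Ш_an = 81` — types-the-object-of; closes NONE.

## What (x10 GEN 43, X10-AUDIT §49)

On the referee's state of record after ROUND 622 the register token `('YZ26', 3)` survives on exactly TWO classes,
both flag-only: `246740j1` (r = 1; recorded `…Records350`, OFFER-D3R1 ADDENDUM-2) and `384400cx1` (r = 0, `#Ш_an = 81`).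
GEN 42's Ш-cell road (`SurjThreeShaCells`: Wuthrich Prop. 21 + `#Sel^(3) = 9` + `ord₃ #Ш_an ≤ 2`) does not reach
`ord₃ #Ш_an = 4`, and the two-engine exact `3`-descent of THIS gen (kit j274125: x11b `desc3lib.gp` × x10b
`desc3full_e2.py`, EXACT(bnfcertify1+3sat) both, subspace cross-check True) returns `dim_𝔽₃ Sel^(3) = 2` for BOTH
`#Ш_an = 81` cells of row D3 (`384400cx1`, `210392t1`) — so `Ш[3] ≅ (ℤ/3)²` and the descent ALONE bounds `#Ш` below by
`9` only.  What is missing is EXACTLY "`Ш(E/ℚ)[9] ≠ Ш(E/ℚ)[3]`", i.e. ONE element of order `9` in `Ш(E/ℚ)` (equivalently: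
one everywhere-locally-soluble `9`-covering lying over a non-trivial `3`-covering — a SECOND `3`-descent in the sense of
Creutz, Math. Comp. 83 (2014); or: the Cassels–Tate pairing on `Sel^(3)` is IDENTICALLY ZERO, by Cassels 1998 §1).
Neither instrument exists in the cell for a SURJECTIVE mod-`3` image (the CTP-on-Sel³ route-A "octic" path is walled
since GEN 17/18, X10-AUDIT §23.9/§24; second descents are Magma-only).  THIS FILE proves that that ONE certificate is
ALL that is missing:

* `pow_four_dvd_natCard_of_alternating_of_torsionBy` — PURE GROUP THEORY: a finite abelian group `T` with a
  non-degenerate alternating pairing `T × T → ℚ/ℤ`, `#T[p] = p²` and an element of order `p²` has `p⁴ ∣ #T`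
  (the radical `T[p] ∩ pT` of the induced `𝔽_p`-form on `T[p]` has index a perfect EVEN power of `p` in `T[p]`
  — the tree's `natCard_torsionBy_eq_mul_sq` — and is non-zero, so it is all of `T[p]`; then `T[p] ≤ pT` gives
  `#T = #T[p] · #pT` with `p² ∣ #pT`).  No structure theorem.
* `pow_four_dvd_shaOrder_of_casselsTate_of_card_selmerThree_of_orderNine` — for `E/ℚ` of rank `0` with
  `3 ∤ #E(ℚ)_tors`, `Ш` finite, `#Sel^(3) = 9` and ONE element of order `9` in `Ш`: `81 ∣ #Ш` — the pairing is
  bsd.S18 (`hCT : exists_casselsTate_pairing`, Cassels 1962 / Silverman X.4.14: alternating, kernel = divisible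
  elements = `0` for finite `Ш`), `#Ш[3] = #Sel^(3)` is Silverman X.4.2 (a) (`card_sha_inf_torsionBy_eq_card_selmerGroup_of_rankZero`).
* `missingLowerBoundAt_three_of_casselsTate_of_card_selmerThree_of_orderNine` — the typed LOWER half at
  `ord₃ #Ш_an ≤ 4`; `bsdp_three_rankZero_surj_shaCellNine_of_wuthrich_of_casselsTate` — with Wuthrich Prop. 21
  (UPPER half, surjective image, `L(E,1) ≠ 0`) ⟹ Miller's `BSD(E,3)`;
  `MuZeroRoad.bsdp_three_rankZero_shaCellNine_of_ainvs_of_surjWitnesses` — the record shape off a literal model with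
  the image DECIDED IN THE KERNEL; and the two per-cell records `MuZeroRoad.bsdp_three_sha81_e384400cx1_of_orderNine`,
  `MuZeroRoad.bsdp_three_sha81_e210392t1_of_orderNine` with the MISSING certificate `h9` DISPLAYED.

Binders: PUBLISHED `hW` (A6), `hCT` (bsd.S18), `hGZK` (A18), `hmodP` (A19); census `hL`, `hq`/`hv`; certificates `hcard`
(two-engine exact `3`-descent, IN HAND) and **`h9 : ∃ y : Ш(E/ℚ), 9 • y = 0 ∧ 3 • y ≠ 0` (NOT in hand — the typed
missing object)**.  NO Kato, NO F1, NO `μ`-certificate, NO Yan–Zhu.  Per pair; nothing booked.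

References: C. Wuthrich, Doc. Math. 19 (2014) Prop. 21 [Wuthrich2014]; J. W. S. Cassels, J. reine angew. Math. 211
(1962) [Cassels1962ArithmeticIV] and 494 (1998) §1 [Cassels1998]; J. H. Silverman, AEC (2009) Thm. X.4.2 (a),
X.4.14, Ex. 10.20 [SilvermanAEC2009]; B. Creutz, Math. Comp. 83 (2014) [Creutz2014]; J.-P. Serre, Invent. Math. 15
(1972) §2.4 Prop. 15 [Serre1972]; R. L. Miller, LMS J. Comput. Math. 14 (2011) Def. 1.1 [Miller2011LMS];
J. E. Cremona, tables [Cremona2006].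
-/

set_option autoImplicit false

noncomputable section

open scoped Classical MatrixGroups ModularForm AddSubgroup

open CongruenceSubgroup WeierstrassCurve Field Literature.NumberTheory.GaloisRepresentations
  Literature.NumberTheory.GaloisCohomology Literature.NumberTheory.EllipticCurves
  Literature.NumberTheory.EllipticCurves.ModularForms Literature.NumberTheory.EllipticCurves.Rank1Residual
  Literature.NumberTheory.EllipticCurves.Rank1Residual.Typed
  Literature.NumberTheory.EllipticCurves.Wuthrich2014
  Literature.NumberTheory.EllipticCurves.Rank1Residual.X11RankOneCertificates
  Literature.GroupTheory.FiniteAbelian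
  Summit.BirchSwinnertonDyer.BirchSwinnertonDyer.Rank1Residual.IntModel
  Summit.BirchSwinnertonDyer.BirchSwinnertonDyer.Rank1Residual.X11RankOne
  Summit.BirchSwinnertonDyer.BirchSwinnertonDyer.Theorems.Rank1ResidualX1Defs
  Summit.BirchSwinnertonDyer.BirchSwinnertonDyer.Rank1Residual

namespace Summit.BirchSwinnertonDyer.Rank1Residual.X10

/-! ### §1 Group theory: `#T[p] = p²` + an element of order `p²` + a non-degenerate alternating pairing ⟹ `p⁴ ∣ #T` -/

section GroupTheory

universe u

variable {T : Type u} [AddCommGroup T] [Finite T]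

/-- **A finite abelian group `T` with a non-degenerate alternating pairing `B : T × T → ℚ/ℤ`, `#T[p] = p²` and an
element `y` of order `p²` satisfies `p⁴ ∣ #T`.**  The tree's `natCard_torsionBy_eq_mul_sq` gives
`#T[p] = #(T[p] ∩ pT) · p^{2j}`; `p • y` is a non-zero element of `T[p] ∩ pT`, so `#(T[p] ∩ pT) ∈ {p, p²}` and the
even exponent forces `T[p] ∩ pT = T[p]`, i.e. `T[p] ≤ pT`; finally `#T = #T[p] · #pT` (first isomorphism theorem for
`x ↦ p • x`) with `p² = #T[p] ∣ #pT`.  Elementary; no structure theorem. [folklore] -/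
theorem pow_four_dvd_natCard_of_alternating_of_torsionBy (p : ℕ) [hp : Fact p.Prime]
    (B : T →+ T →+ AddCircle (1 : ℚ)) (halt : ∀ x, B x x = 0) (hnd : ∀ x, (∀ y, B x y = 0) → x = 0)
    (hcard : Nat.card T[(p : ℤ)] = p ^ 2) {y : T} (hy : p ^ 2 • y = 0) (hy' : p • y ≠ 0) :
    p ^ 4 ∣ Nat.card T := by
  obtain ⟨ι, hι⟩ := exists_circleTorsion_toZMod_injective p
  obtain ⟨j, hj⟩ := natCard_torsionBy_eq_mul_sq p B halt hnd ι hι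
  set f : T →+ T := nsmulAddMonoidHom (α := T) p with hf
  set R : AddSubgroup T := T[(p : ℤ)] ⊓ f.range with hR
  have hRle : R ≤ T[(p : ℤ)] := inf_le_left
  -- `p • y` is a non-zero element of the radical `R`
  have hxR : p • y ∈ R := by
    refine AddSubgroup.mem_inf.mpr ⟨AddSubgroup.torsionBy.nsmul_iff.mpr ?_, ⟨y, by rw [hf, nsmulAddMonoidHom_apply]⟩⟩
    rw [← mul_nsmul, ← pow_two, hy]
  have hR1 : 1 < Nat.card R := by
    rw [Finite.one_lt_card_iff_nontrivial]
    exact ⟨⟨⟨p • y, hxR⟩, 0, fun h ↦ hy' (congrArg Subtype.val h)⟩⟩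
  -- `#R ∣ p²`, so `#R = p^a` with `1 ≤ a ≤ 2`; the even exponent `p² = #R · p^{2j}` forces `a = 2`
  have hRdvd : Nat.card R ∣ p ^ 2 := hcard ▸ AddSubgroup.card_dvd_of_le hRle
  obtain ⟨a, ha2, haR⟩ := (Nat.dvd_prime_pow hp.out).mp hRdvd
  have hp1 : 1 < p := hp.out.one_lt
  have ha1 : 1 ≤ a := by
    by_contra h0
    have : a = 0 := by omega
    rw [this, pow_zero] at haR
    omega
  rw [hcard, haR, ← pow_add] at hj
  have hexp : 2 = a + 2 * j := Nat.pow_right_injective hp.out.two_le hj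
  have ha : a = 2 := by omega
  -- hence `R = T[p]`, i.e. `T[p] ≤ pT`
  have hReq : R = T[(p : ℤ)] :=
    AddSubgroup.eq_of_le_of_card_ge hRle (by rw [hcard, haR, ha])
  have hle : T[(p : ℤ)] ≤ f.range := by rw [← hReq]; exact inf_le_right
  -- `#T = #T[p] · #pT` and `p² ∣ #pT`
  have hker : f.ker = T[(p : ℤ)] := ker_nsmulAddMonoidHom_eq p
  have hT : Nat.card T = Nat.card f.range * Nat.card f.ker := by
    rw [AddSubgroup.card_eq_card_quotient_mul_card_addSubgroup f.ker,
      Nat.card_congr (QuotientAddGroup.quotientKerEquivRange f).toEquiv]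
  have hrange : p ^ 2 ∣ Nat.card f.range := hcard ▸ AddSubgroup.card_dvd_of_le hle
  rw [hT, hker, hcard, show p ^ 4 = p ^ 2 * p ^ 2 by ring]
  exact Nat.mul_dvd_mul hrange dvd_rfl

end GroupTheory

/-! ### §2 `Ш(E/ℚ)`: rank `0`, `3 ∤ #E(ℚ)_tors`, `#Sel^(3) = 9`, an element of order `9`, Cassels–Tate ⟹ `81 ∣ #Ш` -/

section ShaCell

variable (W : WeierstrassCurve ℚ) [W.IsElliptic] [W.IsGloballyMinimal]

omit [W.IsGloballyMinimal] in
/-- **`81 ∣ #Ш(E/ℚ)` from ONE exact `3`-descent, ONE element of order `9` and the Cassels–Tate pairing.**  Rank `0` and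
`3 ∤ #E(ℚ)_tors` give `#Ш[3] = #Sel^(3) = 9` (Silverman X.4.2 (a), the tree's
`card_sha_inf_torsionBy_eq_card_selmerGroup_of_rankZero`); `Ш` finite makes the bsd.S18 pairing (`hCT`: alternating,
kernel = divisible elements; `divisibleElements_eq_bot_of_finite`) non-degenerate; then
`pow_four_dvd_natCard_of_alternating_of_torsionBy`.  (`#Ш := Nat.card Ш`.)
[cite: SilvermanAEC2009, Thm. X.4.2 (a) and Thm. X.4.14] [cite: Cassels1962ArithmeticIV] -/
theorem pow_four_dvd_shaOrder_of_casselsTate_of_card_selmerThree_of_orderNine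
    (hCT : exists_casselsTate_pairing (K := ℚ)) [Finite W.sha]
    (hrank : W.mordellWeilRank = 0) (htors : ¬ 3 ∣ W.torsionOrder)
    (hcard : Nat.card (W.selmerGroup (3 : ℤ)) = 9) (h9 : ∃ y : W.sha, 9 • y = 0 ∧ 3 • y ≠ 0) :
    81 ∣ W.shaOrder := by
  haveI : Fact (Nat.Prime 3) := ⟨by norm_num⟩
  obtain ⟨B, halt, hker⟩ := hCT W
  have hnd : ∀ x : W.sha, (∀ y, B x y = 0) → x = 0 := fun x hx ↦ by
    have hmem : x ∈ AddSubgroup.divisibleElements W.sha := (hker x).mp hx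
    rwa [divisibleElements_eq_bot_of_finite, AddSubgroup.mem_bot] at hmem
  have h3 : Nat.card (↥W.sha)[((3 : ℕ) : ℤ)] = 3 ^ 2 := by
    rw [card_torsionBy_coe_eq_card_inf, card_sha_inf_torsionBy_eq_card_selmerGroup_of_rankZero W 3 hrank htors]
    exact_mod_cast hcard
  obtain ⟨y, hy, hy'⟩ := h9
  have h := pow_four_dvd_natCard_of_alternating_of_torsionBy 3 B halt hnd h3 (y := y) (by simpa using hy)
    (by simpa using hy')
  rw [WeierstrassCurve.shaOrder]
  simpa using h

omit [W.IsGloballyMinimal] in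
/-- **The typed LOWER half `ord₃ #Ш(E/ℚ)_an ≤ ord₃ #Ш(E/ℚ)` at a rank-`0` pair with `ord₃ #Ш_an ≤ 4` from ONE exact
`3`-descent `#Sel^(3)(E/ℚ) = 9`, ONE element of order `9` in `Ш(E/ℚ)` and the Cassels–Tate pairing** — GZK (`hGZK`)
gives rank `0` and `Ш` finite from analytic rank `0`; `E[3]` irreducible gives `3 ∤ #E(ℚ)_tors`
(`padicValNat_torsionOrder_eq_zero_of_irreducible`); then `81 ∣ #Ш`.
[cite: SilvermanAEC2009, Thm. X.4.2 (a) and Thm. X.4.14] [cite: Miller2011LMS, Def. 1.1 (arXiv:1010.2431 p. 3)] -/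
theorem missingLowerBoundAt_three_of_casselsTate_of_card_selmerThree_of_orderNine
    (hCT : exists_casselsTate_pairing (K := ℚ))
    (hGZK : rank_eq_analyticRank_of_analyticRank_le_one) (hirr : W.HasIrreducibleModPGaloisRep 3)
    (hr0 : W.analyticRank = 0) (hcard : Nat.card (W.selmerGroup (3 : ℤ)) = 9)
    (h9 : ∃ y : W.sha, 9 • y = 0 ∧ 3 • y ≠ 0)
    {q : ℚ} (hq : shaAn W = (q : ℂ)) (hv : padicValRat 3 q ≤ 4) : Typed.MissingLowerBoundAt W 3 := by
  haveI : Fact (Nat.Prime 3) := ⟨by norm_num⟩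
  obtain ⟨hrk, hfin⟩ := hGZK W (by omega)
  have hrank : W.mordellWeilRank = 0 := hrk.trans hr0
  haveI : Finite W.sha := hfin
  have htors : ¬ 3 ∣ W.torsionOrder := by
    intro hd
    have h0 := padicValNat_torsionOrder_eq_zero_of_irreducible W 3 hirr
    rw [padicValNat.eq_zero_iff] at h0
    rcases h0 with h | h | h
    · exact absurd h (by norm_num)
    · exact absurd h W.torsionOrder_pos_holds.ne'
    · exact h hd
  have h81 : 81 ∣ W.shaOrder :=
    pow_four_dvd_shaOrder_of_casselsTate_of_card_selmerThree_of_orderNine W hCT hrank htors hcard h9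
  have hn : W.shaOrder ≠ 0 := (WeierstrassCurve.shaOrder_pos W hfin).ne'
  have hle : 4 ≤ padicValNat 3 W.shaOrder := by
    rw [← padicValNat_dvd_iff_le hn]; simpa using h81
  refine ⟨q, hq, hv.trans ?_⟩
  exact_mod_cast hle

/-- **D3 ∩ {r = 0}, the `#Ш_an = 81` cell per pair, TYPED: `3` good, `ρ̄_{E,3}` onto, `L(E,1) ≠ 0`, `ord₃ #Ш(E/ℚ)_an ≤ 4`:
Wuthrich 2014 Prop. 21 ∧ ONE exact `3`-descent `#Sel^(3)(E/ℚ) = 9` ∧ ONE element of order `9` in `Ш(E/ℚ)` ∧ the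
Cassels–Tate pairing ⟹ Miller's `BSD(E,3)`.**  UPPER half `ord₃ #Ш ≤ ord₃ #Ш_an` = Prop. 21 (as in GEN 42's
`bsdp_three_rankZero_surj_shaCell_of_wuthrich_of_card_selmerThree`); LOWER half `4 ≤ ord₃ #Ш` from
`missingLowerBoundAt_three_of_casselsTate_of_card_selmerThree_of_orderNine`.  Binders: PUBLISHED `hW` (A6), `hCT`
(bsd.S18), `hGZK` (A18), `hmodP` (A19); data `hgood`, `hsurj`, `hL`, `hq`/`hv`; certificates `hcard` (in hand) and
`h9` (the MISSING `9`-covering certificate).  NO Kato / F1 / `μ`-certificate / Yan–Zhu.  Per pair; nothing booked.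
[cite: Wuthrich2014, Prop. 21 (p. 400)] [cite: SilvermanAEC2009, Thm. X.4.2 (a) and Thm. X.4.14]
[cite: Miller2011LMS, Def. 1.1 (arXiv:1010.2431 p. 3)] -/
theorem bsdp_three_rankZero_surj_shaCellNine_of_wuthrich_of_casselsTate (hW : Wuthrich2014.sha_dvd_analyticSha)
    (hCT : exists_casselsTate_pairing (K := ℚ))
    (hGZK : rank_eq_analyticRank_of_analyticRank_le_one) (hmodP : nonempty_modularParametrizationData)
    (hgood : W.HasGoodReductionAtPrime 3) (hsurj : Surj W 3) (hL : W.entireLFunction 1 ≠ 0)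
    (hcard : Nat.card (W.selmerGroup (3 : ℤ)) = 9) (h9 : ∃ y : W.sha, 9 • y = 0 ∧ 3 • y ≠ 0)
    {q : ℚ} (hq : shaAn W = (q : ℂ)) (hv : padicValRat 3 q ≤ 4) : BSDp W 3 := by
  haveI : Fact (Nat.Prime 3) := ⟨by norm_num⟩
  haveI : NeZero (W.conductorNorm ℤ) := ⟨(W.conductorNorm_pos_holds).ne'⟩
  obtain ⟨Dm⟩ := hmodP W
  have hr0 : W.analyticRank = 0 :=
    (W.analyticRank_eq_zero_iff_holds Dm.isNewformOf.hasEntireLFunction).mpr hL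
  have hirr : W.HasIrreducibleModPGaloisRep 3 :=
    hasIrreducibleModPGaloisRep_of_hasSurjectiveModNGaloisRep W 3 hsurj
  -- UPPER half: Wuthrich Prop. 21 (the proof of `Typed.missingUpperBoundAt_of_wuthrich`, with `hL` in hand)
  have hup : Typed.MissingUpperBoundAt W 3 := by
    obtain ⟨hrank, hfin⟩ := hGZK W (by omega)
    have hmw0 : W.mordellWeilRank = 0 := by omega
    haveI hE : Finite W.toAffine.Point := W.finite_point_of_rank_zero hmw0
    obtain ⟨q', hq', -, hle⟩ := padicValNat_shaOrder_le_of_sha_dvd hW W 3 (by norm_num) hL hE hfin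
      (WeierstrassCurve.HasGoodReduction.not_hasAdditiveReduction _ hgood) (Or.inr hsurj)
    obtain ⟨-, -, -, hshaAn⟩ := shaAn_eq_of_L_one_div_eq hGZK W hL hq'
    exact ⟨_, hshaAn, hle⟩
  exact bsdp_of_missingPPartAt W 3 hGZK (by rw [hr0]; exact Nat.zero_le _)
    (missingPPartAt_of_lower_of_upper W 3
      (missingLowerBoundAt_three_of_casselsTate_of_card_selmerThree_of_orderNine W hCT hGZK hirr hr0 hcard h9 hq hv)
      hup)

end ShaCell

namespace MuZeroRoad

/-- **The `#Ш_an = 81` Ш-cell record shape with the IMAGE DECIDED IN THE KERNEL: Wuthrich Prop. 21 ∧ `#Sel^(3)(E/ℚ) = 9`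
∧ ONE element of order `9` in `Ш(E/ℚ)` ∧ Cassels–Tate ∧ `L(E,1) ≠ 0` ∧ `ord₃ #Ш_an ≤ 4` ⟹ Miller's `BSD(E,3)` for a cell
given by a literal integer model** — good reduction at `3` from `3 ∤ Δ`; `ρ̄_{E,3}` onto from the two Frobenius witnesses
of `surj_three_of_ainvs_of_witnesses` (`ℓ₁`: irreducible characteristic polynomial mod `3`; `ℓ₂ ≡ 1`,
`a_{ℓ₂} ≡ 2 (mod 3)`, `9 ∤ #Ẽ(𝔽_{ℓ₂})`: a transvection); displayed: PUBLISHED `hW` (A6), `hCT` (bsd.S18), `hGZK` (A18),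
`hmodP` (A19); census `hL`, `hq`/`hv`; certificates `hcard` (ONE two-engine exact `3`-descent) and `h9` (ONE element of
order `9` — a `9`-covering certificate).  Per pair; nothing booked. [cite: Wuthrich2014, Prop. 21 (p. 400)]
[cite: SilvermanAEC2009, Thm. X.4.2 (a) and Thm. X.4.14] [cite: Serre1972, §2.4 Prop. 15, §2.8]
[cite: Miller2011LMS, Def. 1.1 (arXiv:1010.2431 p. 3)] -/
theorem bsdp_three_rankZero_shaCellNine_of_ainvs_of_surjWitnesses
    (hWu : Wuthrich2014.sha_dvd_analyticSha) (hCT : exists_casselsTate_pairing (K := ℚ))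
    (hGZK : rank_eq_analyticRank_of_analyticRank_le_one) (hmodP : nonempty_modularParametrizationData)
    (a1 a2 a3 a4 a6 : ℤ) {W : WeierstrassCurve ℚ} [W.IsElliptic] [W.IsGloballyMinimal]
    (hW : integralModelInt W = ⟨a1, a2, a3, a4, a6⟩)
    (ℓ₁ n₁ ℓ₂ n₂ : ℕ) [Fact ℓ₁.Prime] [Fact ℓ₂.Prime]
    (h3Δ : ¬ (3 : ℤ) ∣ discOf [a1, a2, a3, a4, a6])
    (hℓ₁2 : ℓ₁ ≠ 2) (hℓ₁3 : ℓ₁ ≠ 3) (hℓ₁Δ : ¬ (ℓ₁ : ℤ) ∣ discOf [a1, a2, a3, a4, a6])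
    (hc₁ : countPoints [a1, a2, a3, a4, a6] ℓ₁ = n₁)
    (hnoroot : ∀ t : ℕ, t < 3 → ¬ (3 : ℤ) ∣ (t : ℤ) ^ 2 - ((ℓ₁ : ℤ) + 1 - n₁) * t + ℓ₁)
    (hℓ₂2 : ℓ₂ ≠ 2) (hℓ₂3 : ℓ₂ ≠ 3) (hℓ₂Δ : ¬ (ℓ₂ : ℤ) ∣ discOf [a1, a2, a3, a4, a6])
    (hc₂ : countPoints [a1, a2, a3, a4, a6] ℓ₂ = n₂)
    (hdet₂ : (ℓ₂ : ZMod 3) = 1) (htr₂ : (((ℓ₂ : ℤ) + 1 - n₂ : ℤ) : ZMod 3) = 2) (hsq : ¬ 9 ∣ n₂)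
    (hL : W.entireLFunction 1 ≠ 0)
    (hcard : Nat.card (W.selmerGroup (3 : ℤ)) = 9) (h9 : ∃ y : W.sha, 9 • y = 0 ∧ 3 • y ≠ 0)
    {q : ℚ} (hq : shaAn W = (q : ℂ)) (hv : padicValRat 3 q ≤ 4) : BSDp W 3 := by
  haveI : Fact (Nat.Prime 3) := ⟨by norm_num⟩
  have hgood : W.HasGoodReductionAtPrime 3 :=
    hasGoodReductionAtPrime_of_not_dvd W 3 (by rw [minimalDiscriminantInt_eq hW, intCurve_Δ]; exact h3Δ)
  exact bsdp_three_rankZero_surj_shaCellNine_of_wuthrich_of_casselsTate W hWu hCT hGZK hmodP hgood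
    (surj_three_of_ainvs_of_witnesses a1 a2 a3 a4 a6 hW ℓ₁ n₁ ℓ₂ n₂ hℓ₁2 hℓ₁3 hℓ₁Δ hc₁ hnoroot hℓ₂2 hℓ₂3
      hℓ₂Δ hc₂ hdet₂ htr₂ hsq) hL hcard h9 hq hv

/-! ### The two `#Ш_an = 81` cells of row D3 (both `dim_𝔽₃ Sel^(3) = 2`, kit j274125) — records MODULO the
`9`-covering certificate `h9` -/

/-- **`BSD(E,3)` AT THE PAIR `(384400cx1, 3)` MODULO ONE `9`-COVERING CERTIFICATE** — THE LAST rank-`0` class carrying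
`('YZ26', 3)` on the referee's state of record (flag-only literal).  Cremona model `[0, -1, 0, -31032043408, -2104133377880688]`,
`N = 384400 = 2^4·5^2·31^2`; IN THE KERNEL: `3 ∤ Δ` (good at `3`; `#Ẽ(𝔽₃) = 2`, `a₃ = 2`, ordinary), `ρ̄_{E,3}` ONTO by
`ℓ₁ = 11` (`#Ẽ(𝔽_{11}) = 14`, `a_{11} = -2`, `X² + 2X + 11` root-free mod `3`) and `ℓ₂ = 13` (`#Ẽ(𝔽_{13}) = 12`,
`a_{13} = 2`, `13 ≡ 1 (mod 3)`, `9 ∤ 12`: a transvection).  Cremona `allbsd`: analytic rank `0`, `#E(ℚ)_tors = 2`,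
`∏ c_ℓ = 32`, `#Ш_an = 81`.  DISPLAYED: PUBLISHED `hW` (A6), `hCT` (bsd.S18), `hGZK` (A18), `hmodP` (A19); census `hL`,
`hq`/`hv` (`ord₃ #Ш_an = 4`); certificate `hcard` IN HAND (`#Sel^(3)(E/ℚ) = 9`: two-engine EXACT `3`-descent
`dim Sel₃ = 2`, kit j274125: engine 1 = unit x11b `desc3lib.gp` (MATCH, EXACT(bnfcertify1+3sat), 62.8 s) × engine 2 =
unit x10b `desc3full_e2.py` rev 3 (EXACT(bnfcertify1+3sat), dimSha[3]=2, `xcheck_same_subspace = True`, e1_dim = 2,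
e1_exact = 1)); certificate **`h9` NOT IN HAND** (an element of order `9` in `Ш(E/ℚ)`: a second `3`-descent / a ZERO
Cassels–Tate pairing on `Sel^(3)` — no instrument in the cell for a surjective mod-`3` image).  Types-the-object-of;
closes NONE; nothing booked. [cite: Wuthrich2014, Prop. 21 (p. 400)] [cite: SilvermanAEC2009, Thm. X.4.2 (a) and Thm. X.4.14]
[cite: Serre1972, §2.4 Prop. 15, §2.8] [cite: Miller2011LMS, Def. 1.1 (arXiv:1010.2431 p. 3)]
[cite: Cremona2006, Table 1 (Cremona label 384400cx1)] -/
theorem bsdp_three_sha81_e384400cx1_of_orderNine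
    (hW : Wuthrich2014.sha_dvd_analyticSha) (hCT : exists_casselsTate_pairing (K := ℚ))
    (hGZK : rank_eq_analyticRank_of_analyticRank_le_one) (hmodP : nonempty_modularParametrizationData)
    (W : WeierstrassCurve ℚ) [W.IsElliptic] [W.IsGloballyMinimal]
    (hI : integralModelInt W = ⟨0, (-1), 0, (-31032043408), (-2104133377880688)⟩) (hL : W.entireLFunction 1 ≠ 0)
    (hcard : Nat.card (W.selmerGroup (3 : ℤ)) = 9) (h9 : ∃ y : W.sha, 9 • y = 0 ∧ 3 • y ≠ 0)
    {q : ℚ} (hq : shaAn W = (q : ℂ)) (hv : padicValRat 3 q = 4) : BSDp W 3 :=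
  haveI : Fact (Nat.Prime 11) := ⟨by norm_num⟩
  haveI : Fact (Nat.Prime 13) := ⟨by norm_num⟩
  bsdp_three_rankZero_shaCellNine_of_ainvs_of_surjWitnesses hW hCT hGZK hmodP
    0 (-1) 0 (-31032043408) (-2104133377880688) hI 11 14 13 12 (by decide +kernel) (by decide) (by decide)
    (by decide +kernel) (by decide +kernel) (by decide +kernel) (by decide) (by decide) (by decide +kernel)
    (by decide +kernel) (by decide) (by decide) (by decide) hL hcard h9 hq hv.le

/-- **`BSD(E,3)` AT THE PAIR `(210392t1, 3)` MODULO ONE `9`-COVERING CERTIFICATE** — the other `#Ш_an = 81` cell of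
row D3 ∩ {r = 0} (its `('YZ26', 3)` entry was struck by another door before ROUND 622; this is a second, typed road).
Cremona model `[0, -1, 0, -228383752896, -42009269954506708]`, `N = 210392 = 2^3·7·13·17^2`; IN THE KERNEL: `3 ∤ Δ`
(good at `3`; `#Ẽ(𝔽₃) = 2`, `a₃ = 2`, ordinary), `ρ̄_{E,3}` ONTO by `ℓ₁ = 5` (`#Ẽ(𝔽_{5}) = 7`, `a_{5} = -1`,
`X² + X + 5` root-free mod `3`) and `ℓ₂ = 73` (`#Ẽ(𝔽_{73}) = 66`, `a_{73} = 8 ≡ 2`, `73 ≡ 1 (mod 3)`, `9 ∤ 66`: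
a transvection).  Cremona `allbsd`: analytic rank `0`, `#E(ℚ)_tors = 1`, `∏ c_ℓ = 18`, `#Ш_an = 81`.  DISPLAYED:
PUBLISHED `hW`, `hCT`, `hGZK`, `hmodP`; census `hL`, `hq`/`hv` (`ord₃ #Ш_an = 4`); certificate `hcard` IN HAND
(two-engine EXACT `3`-descent `dim Sel₃ = 2`, kit j274125: engine 1 x11b `desc3lib.gp` MATCH EXACT(bnfcertify1+3sat)
0.8 s × engine 2 x10b `desc3full_e2.py` EXACT, dimSha[3]=2, `xcheck_same_subspace = True`, e1_dim = 2, e1_exact = 1);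
certificate **`h9` NOT IN HAND**.  Types-the-object-of; closes NONE; nothing booked.
[cite: Wuthrich2014, Prop. 21 (p. 400)] [cite: SilvermanAEC2009, Thm. X.4.2 (a) and Thm. X.4.14]
[cite: Serre1972, §2.4 Prop. 15, §2.8] [cite: Miller2011LMS, Def. 1.1 (arXiv:1010.2431 p. 3)]
[cite: Cremona2006, Table 1 (Cremona label 210392t1)] -/
theorem bsdp_three_sha81_e210392t1_of_orderNine
    (hW : Wuthrich2014.sha_dvd_analyticSha) (hCT : exists_casselsTate_pairing (K := ℚ))
    (hGZK : rank_eq_analyticRank_of_analyticRank_le_one) (hmodP : nonempty_modularParametrizationData)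
    (W : WeierstrassCurve ℚ) [W.IsElliptic] [W.IsGloballyMinimal]
    (hI : integralModelInt W = ⟨0, (-1), 0, (-228383752896), (-42009269954506708)⟩) (hL : W.entireLFunction 1 ≠ 0)
    (hcard : Nat.card (W.selmerGroup (3 : ℤ)) = 9) (h9 : ∃ y : W.sha, 9 • y = 0 ∧ 3 • y ≠ 0)
    {q : ℚ} (hq : shaAn W = (q : ℂ)) (hv : padicValRat 3 q = 4) : BSDp W 3 :=
  haveI : Fact (Nat.Prime 5) := ⟨by norm_num⟩
  haveI : Fact (Nat.Prime 73) := ⟨by norm_num⟩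
  bsdp_three_rankZero_shaCellNine_of_ainvs_of_surjWitnesses hW hCT hGZK hmodP
    0 (-1) 0 (-228383752896) (-42009269954506708) hI 5 7 73 66 (by decide +kernel) (by decide) (by decide)
    (by decide +kernel) (by decide +kernel) (by decide +kernel) (by decide) (by decide) (by decide +kernel)
    (by decide +kernel) (by decide) (by decide) (by decide) hL hcard h9 hq hv.le

end MuZeroRoad

end Summit.BirchSwinnertonDyer.Rank1Residual.X10

end
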